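import Literature.Geometry.Riemannian.AbreschGromollExcess
import HarnessLib

/-!
# The Abresch–Gromoll maximum principle and lemma under `Ric ≥ -(m-1)`

The general-lower-bound companions (hyperbolic model, `Δ r ≤ (m-1) coth r` in the barrier sense)
of `AbreschGromollExcess.lean`, as used by Cheeger–Colding 1996, Prop. 6.2 ("the following
slight generalization of the Abresch–Gromoll inequality … as in [AG], given `x ∈ B₁(p)`, we can
construct … a function `G` … such that `Δ(E - G) < 0` in the barrier sense … `E - G` has no
interior minimum") and announced in Zhu 1997, Remark after Thm. 4.15. We PROVE:
* `upper_barriers_excess_hyperbolic` — the excess `e = d(p,·) + d(q,·) - d(p,q)` has `C²` upper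
  barriers with `Δφ(x) ≤ (m-1)(coth d(p,x) + coth d(q,x)) + ε` at `x ≠ p, q`;
* `comp_edist_le_of_upper_barriers_annulus_hyperbolic` — the maximum principle on a closed
  annulus against a radial profile with `G'' + (m-1) coth(r) G' ≥ b' > b`;
* `abreschGromoll_lemma_hyperbolic` — `u(y) ≤ a c + G(c)` for such a profile;
* `abreschGromoll_lemma_hyperbolic_of_le` — the same with a defect `u(y₀) ≤ δ`
  (Cheeger–Colding 1996, (6.4), (6.8)–(6.10)): `u(y) ≤ a c + G(c) + δ`.
No definitions, no named facts (D-0026). Groundwork for `CheegerColding1997_sphereStability`.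

## References

* J. Cheeger, T. H. Colding, Ann. of Math. 144 (1996) 189–237, Prop. 6.2. [CheegerColding1996]
* S.-H. Zhu, in *Comparison Geometry*, MSRI Publ. 30 (1997) 221–262, Lemma 4.14, Remark after
  Thm. 4.15. [Zhu1997ComparisonRicci]
* U. Abresch, D. Gromoll, J. Amer. Math. Soc. 3 (1990) 355–374. [AbreschGromoll1990]
-/

noncomputable section

open Bundle Set Function Filter
open scoped Manifold ContDiff Topology ENNReal NNReal Real

namespace Literature.Geometry.Riemannian

open Lorentzian Lorentzian.PseudoRiemannianMetric

/-! ### §1 Barriers for the excess, `Ric ≥ -(m-1)` -/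

section ExcessHyp

variable {E : Type*} [NormedAddCommGroup E] [NormedSpace ℝ E] [FiniteDimensional ℝ E]
  [CompleteSpace E] {M : Type*} [TopologicalSpace M] [ChartedSpace E M] [IsManifold 𝓘(ℝ, E) ∞ M]
  [T2Space M]
  (g : PseudoRiemannianMetric 𝓘(ℝ, E) ∞ E (TangentSpace 𝓘(ℝ, E) : M → Type _)) [g.HasLeviCivita]
  [CovariantDerivative.ContMDiffCovariantDerivative g.leviCivita 1]
  [CovariantDerivative.ContMDiffCovariantDerivative g.leviCivita ∞]

/-- **Barriers for the excess function, `Ric ≥ -(m-1)`** (Cheeger–Colding 1996, §1 and proof of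
Prop. 6.2: Laplacian comparison for `E` in the barrier sense): at every `x ≠ p, q` and for every
`ε > 0` the excess has a `C²` upper barrier `φ` at `x` with
`Δ_g φ(x) ≤ (m-1)(coth d(p,x) + coth d(q,x)) + ε` (`upper_barriers_add`, `upper_barriers_edist`).
[cite: CheegerColding1996, §1, Prop. 6.2] [cite: Calabi1958] -/
theorem upper_barriers_excess_hyperbolic [ConnectedSpace M] (hg : g.IsRiemannian)
    (hc : IsGeodesicallyComplete g.leviCivita)
    (hRic : ∀ (x : M) (w : TangentSpace 𝓘(ℝ, E) x),
      -((Module.finrank ℝ E : ℝ) - 1) * g.val x w w ≤ g.leviCivita.ricci x w w)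
    {p q x : M} (hxp : x ≠ p) (hxq : x ≠ q) :
    ∀ ε > 0, ∃ φ : M → ℝ, (∀ᶠ x' in 𝓝 x, ContMDiffAt 𝓘(ℝ, E) 𝓘(ℝ, ℝ) 2 φ x') ∧
      IsLocalMax (fun x' ↦ ((g.edist hg p x').toReal + (g.edist hg q x').toReal -
        (g.edist hg p q).toReal) - φ x') x ∧
        g.laplaceBeltrami φ x ≤ ((Module.finrank ℝ E : ℝ) - 1) *
          (Real.cosh (g.edist hg p x).toReal / Real.sinh (g.edist hg p x).toReal +
            Real.cosh (g.edist hg q x).toReal / Real.sinh (g.edist hg q x).toReal) + ε := by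
  intro ε hε
  obtain ⟨φ, hφ, hmax, hΔ⟩ := upper_barriers_add g (x := x)
    (u₁ := fun x' ↦ (g.edist hg p x').toReal) (u₂ := fun x' ↦ (g.edist hg q x').toReal)
    (F₁ := fun x' ↦ ((Module.finrank ℝ E : ℝ) - 1) *
      (Real.cosh (g.edist hg p x').toReal / Real.sinh (g.edist hg p x').toReal))
    (F₂ := fun x' ↦ ((Module.finrank ℝ E : ℝ) - 1) *
      (Real.cosh (g.edist hg q x').toReal / Real.sinh (g.edist hg q x').toReal))
    (upper_barriers_edist g hg hc hRic hxp)
    (upper_barriers_edist g hg hc hRic hxq) ε hε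
  refine ⟨φ, hφ, ?_, by rw [mul_add]; exact hΔ⟩
  filter_upwards [hmax] with x' h
  have h' : (g.edist hg p x').toReal + (g.edist hg q x').toReal - φ x' ≤
      (g.edist hg p x).toReal + (g.edist hg q x).toReal - φ x := h
  show (g.edist hg p x').toReal + (g.edist hg q x').toReal - (g.edist hg p q).toReal - φ x' ≤
    (g.edist hg p x).toReal + (g.edist hg q x).toReal - (g.edist hg p q).toReal - φ x
  linarith


end ExcessHyp

/-! ### §2 The Abresch–Gromoll maximum principle on an annulus, `Ric ≥ -(m-1)` -/

section AnnulusHyp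

variable {E : Type*} [NormedAddCommGroup E] [NormedSpace ℝ E] [FiniteDimensional ℝ E]
  [CompleteSpace E] {M : Type*} [TopologicalSpace M] [ChartedSpace E M] [IsManifold 𝓘(ℝ, E) ∞ M]
  [T2Space M]
  (g : PseudoRiemannianMetric 𝓘(ℝ, E) ∞ E (TangentSpace 𝓘(ℝ, E) : M → Type _)) [g.HasLeviCivita]
  [CovariantDerivative.ContMDiffCovariantDerivative g.leviCivita 1]
  [CovariantDerivative.ContMDiffCovariantDerivative g.leviCivita ∞]

/-- **The Abresch–Gromoll maximum principle on an annulus, `Ric ≥ -(m-1)`** (Cheeger–Colding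
1996, proof of Prop. 6.2: "`Δ(E - G) < 0` (in the barrier sense) … `E - G` has no interior
minimum"; Zhu 1997, Lemma 4.14 and the Remark after Thm. 4.15 on general lower Ricci bounds).
On a connected Riemannian `m`-manifold with complete Levi-Civita connection and
`Ric ≥ -(m-1) g`, let `0 < c < R`, let `G` be differentiable on a neighbourhood `(c/2, 2R)` of
`[c, R]` with `G'` differentiable there, nonincreasing on `[c, R]`, with hyperbolic model
Laplacian `G''(r) + (m-1) coth(r) G'(r) ≥ b'` for `r ∈ (c, R)`, and let `u : M → ℝ` be continuous on the
closed annulus `{c ≤ d(y, ·) ≤ R}`, with `C²` upper barriers of Laplacian `≤ b + ε` (every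
`ε > 0`) at every point of the open annulus, where `b < b'`. If `G(c) ≤ u` on the inner sphere
and `G(R) ≤ u` on the outer sphere, then `G ∘ d(y, ·) ≤ u` on the closed annulus
(`le_of_upper_barriers` with the viscosity subsolution property
`le_laplaceBeltrami_comp_edist_of_antitone` of `G ∘ d(y, ·)`).
[cite: CheegerColding1996, Prop. 6.2 (proof)] [cite: Zhu1997ComparisonRicci, Lemma 4.14 (proof)] -/
theorem comp_edist_le_of_upper_barriers_annulus_hyperbolic [ConnectedSpace M] (hg : g.IsRiemannian)
    (hc : IsGeodesicallyComplete g.leviCivita)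
    (hRic : ∀ (x : M) (w : TangentSpace 𝓘(ℝ, E) x),
      -((Module.finrank ℝ E : ℝ) - 1) * g.val x w w ≤ g.leviCivita.ricci x w w)
    (y : M) {c R : ℝ} (hc0 : 0 < c) (hcR : c < R) {G G' G2 : ℝ → ℝ}
    (hGd : ∀ r ∈ Ioo (c / 2) (2 * R), HasDerivAt G (G' r) r)
    (hG2 : ∀ r ∈ Ioo (c / 2) (2 * R), HasDerivAt G' (G2 r) r)
    (hanti : AntitoneOn G (Icc c R)) {b b' : ℝ} (hbb' : b < b')
    (hmodel : ∀ r ∈ Ioo c R, b' ≤ G2 r + ((Module.finrank ℝ E : ℝ) - 1) * (Real.cosh r / Real.sinh r) * G' r)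
    {u : M → ℝ} (hucont : ContinuousOn u {x | ENNReal.ofReal c ≤ g.edist hg y x ∧
      g.edist hg y x ≤ ENNReal.ofReal R})
    (hu : ∀ x, ENNReal.ofReal c < g.edist hg y x → g.edist hg y x < ENNReal.ofReal R →
      ∀ ε > 0, ∃ φ : M → ℝ, (∀ᶠ x' in 𝓝 x, ContMDiffAt 𝓘(ℝ, E) 𝓘(ℝ, ℝ) 2 φ x') ∧
        IsLocalMax (fun x' ↦ u x' - φ x') x ∧ g.laplaceBeltrami φ x ≤ b + ε)
    (hinner : ∀ x, g.edist hg y x = ENNReal.ofReal c → G c ≤ u x)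
    (houter : ∀ x, g.edist hg y x = ENNReal.ofReal R → G R ≤ u x) :
    ∀ x, ENNReal.ofReal c ≤ g.edist hg y x → g.edist hg y x ≤ ENNReal.ofReal R →
      G (g.edist hg y x).toReal ≤ u x := by
  haveI : LocallyCompactSpace M := Manifold.locallyCompact_of_finiteDimensional 𝓘(ℝ, E)
  haveI : RegularSpace M := inferInstance
  have hR : 0 < R := hc0.trans hcR
  set K : Set M := {x | ENNReal.ofReal c ≤ g.edist hg y x ∧ g.edist hg y x ≤ ENNReal.ofReal R}
    with hK_def
  set Ω : Set M := {x | ENNReal.ofReal c < g.edist hg y x ∧ g.edist hg y x < ENNReal.ofReal R}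
    with hΩ_def
  have hdcont : Continuous fun x ↦ g.edist hg y x :=
    (continuous_edist hg).comp (continuous_const.prodMk continuous_id)
  -- compactness of the closed annulus, openness of the open one
  have hK : IsCompact K := by
    have h1 : IsCompact {x | g.edist hg y x ≤ (R.toNNReal : ℝ≥0∞)} :=
      isCompact_setOf_edist_le g le_rfl hg hc y R.toNNReal
    refine h1.of_isClosed_subset (isClosed_le continuous_const hdcont |>.inter
      (isClosed_le hdcont continuous_const)) fun x hx ↦ ?_
    have h : g.edist hg y x ≤ ENNReal.ofReal R := hx.2
    exact h
  have hΩ : IsOpen Ω := (isOpen_lt continuous_const hdcont).inter (isOpen_lt hdcont continuous_const)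
  have hΩK : Ω ⊆ K := fun x hx ↦ ⟨hx.1.le, hx.2.le⟩
  -- real distances on `K`
  have hreal : ∀ x ∈ K, (g.edist hg y x).toReal ∈ Icc c R := fun x hx ↦
    ⟨by have := (ENNReal.ofReal_le_iff_le_toReal (edist_ne_top hg y x)).1 hx.1; exact this,
     (ENNReal.toReal_le_of_le_ofReal hR.le hx.2)⟩
  have hrealΩ : ∀ x ∈ Ω, (g.edist hg y x).toReal ∈ Ioo c R := fun x hx ↦
    ⟨(ENNReal.ofReal_lt_iff_lt_toReal hc0.le (edist_ne_top hg y x)).1 hx.1,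
     (ENNReal.toReal_lt_of_lt_ofReal hx.2)⟩
  -- the maximum principle
  have hmain := le_of_upper_barriers g hK hΩK hΩ (u := u)
    (w := fun x ↦ G (g.edist hg y x).toReal) (F := fun _ ↦ b) (G := fun _ ↦ b') ?_ ?_ ?_ ?_
    (fun _ _ ↦ hbb')
  · intro x hxc hxR
    exact hmain x ⟨hxc, hxR⟩
  · -- upper semicontinuity of `G ∘ d - u` on `K`: continuity
    have hGcont : ContinuousOn G (Icc c R) := fun r hr ↦
      (hGd r ⟨by linarith [hr.1], by linarith [hr.2]⟩).continuousAt.continuousWithinAt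
    have hdreal : ContinuousOn (fun x ↦ (g.edist hg y x).toReal) K :=
      (ENNReal.continuousOn_toReal.comp hdcont.continuousOn fun x _ ↦ edist_ne_top hg y x)
    have hw : ContinuousOn (fun x ↦ G (g.edist hg y x).toReal) K :=
      hGcont.comp hdreal fun x hx ↦ hreal x hx
    exact ((hw.sub hucont).upperSemicontinuousOn)
  · -- boundary: `K \\ Ω` is the union of the two spheres
    intro x hx
    obtain ⟨⟨hxc, hxR⟩, hxΩ⟩ := hx
    have hΩ' : ¬(ENNReal.ofReal c < g.edist hg y x ∧ g.edist hg y x < ENNReal.ofReal R) := hxΩ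
    rcases hxc.eq_or_lt with h | h
    · have h' : g.edist hg y x = ENNReal.ofReal c := h.symm
      show G (g.edist hg y x).toReal ≤ u x
      rw [h', ENNReal.toReal_ofReal hc0.le]
      exact hinner x h'
    · have h2 : g.edist hg y x = ENNReal.ofReal R := by
        by_contra hne
        exact hΩ' ⟨h, lt_of_le_of_ne hxR hne⟩
      show G (g.edist hg y x).toReal ≤ u x
      rw [h2, ENNReal.toReal_ofReal hR.le]
      exact houter x h2
  · intro x hx ε hε
    exact hu x hx.1 hx.2 ε hε
  · -- the viscosity subsolution property of `G ∘ d(y, ·)` on `Ω`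
    intro x hx φ hφ hmax
    have hr := hrealΩ x hx
    have hxy : x ≠ y := by
      intro h
      rw [h, PseudoRiemannianMetric.edist_self, ENNReal.toReal_zero] at hr
      linarith [hr.1]
    -- `δ`-neighbourhood of `d(y, x)` inside `(c, R)`
    set T := (g.edist hg y x).toReal with hT
    have hδ : 0 < min (T - c) (R - T) := lt_min (by linarith [hr.1]) (by linarith [hr.2])
    have hsub : Ioo (T - min (T - c) (R - T)) (T + min (T - c) (R - T)) ⊆ Ioo c R := fun r hr' ↦
      ⟨by linarith [hr'.1, min_le_left (T - c) (R - T)],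
       by linarith [hr'.2, min_le_right (T - c) (R - T)]⟩
    have hsub' : Ioo c R ⊆ Ioo (c / 2) (2 * R) := fun r hr' ↦
      ⟨by linarith [hr'.1], by linarith [hr'.2, hc0]⟩
    have h := le_laplaceBeltrami_comp_edist_of_antitone g hg hc hRic hxy hδ
      (fun s hs ↦ hGd s (hsub' (hsub hs))) (hG2 T (hsub' hr))
      (hanti.mono ((hsub.trans Ioo_subset_Icc_self))) hφ hmax
    exact (hmodel T hr).trans h

end AnnulusHyp
/-! ### §3 The Abresch–Gromoll lemma, `Ric ≥ -(m-1)`, abstract comparison profile -/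

section AGLemmaHyp

variable {E : Type*} [NormedAddCommGroup E] [NormedSpace ℝ E] [FiniteDimensional ℝ E]
  [CompleteSpace E] {M : Type*} [TopologicalSpace M] [ChartedSpace E M] [IsManifold 𝓘(ℝ, E) ∞ M]
  [T2Space M]
  (g : PseudoRiemannianMetric 𝓘(ℝ, E) ∞ E (TangentSpace 𝓘(ℝ, E) : M → Type _)) [g.HasLeviCivita]
  [CovariantDerivative.ContMDiffCovariantDerivative g.leviCivita 1]
  [CovariantDerivative.ContMDiffCovariantDerivative g.leviCivita ∞]

/-- **The Abresch–Gromoll lemma, `Ric ≥ -(m-1)`** (Cheeger–Colding 1996, proof of Prop. 6.2;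
Zhu 1997, Lemma 4.14 and the Remark after Thm. 4.15: "an estimate holds for general lower bounds
on Ricci curvature"), with an abstract comparison profile of hyperbolic model Laplacian
`G'' + (m-1) coth(r) G' ≥ b' > b`. Let `u : M → ℝ` be continuous,
`a`-Lipschitz for the Riemannian distance, `u ≥ 0` on the closed ball `{d(y, ·) ≤ R}`,
`u(y₀) = 0` for some `y₀` with `d(y, y₀) < R` (`a ≥ 0`), and with `C²` upper barriers of Laplacian
`≤ b + ε` at every point of the open ball `{d(y, ·) < R}` ("`Δu ≤ b` in the barrier sense").
Let `0 < c < R` and let `G` be a profile, differentiable with `G'` differentiable on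
`(c/2, 2R)`, strictly decreasing on `[c, R]`, `G(R) = 0`, with model
Laplacian `G'' + (m-1) coth(r) G' ≥ b' > b` on `(c, R)`. Then `u(y) ≤ a c + G(c)`
(proof as for `abreschGromoll_lemma`, with `comp_edist_le_of_upper_barriers_annulus_hyperbolic`).
[cite: CheegerColding1996, Prop. 6.2] [cite: Zhu1997ComparisonRicci, Lemma 4.14] -/
theorem abreschGromoll_lemma_hyperbolic [ConnectedSpace M] (hg : g.IsRiemannian)
    (hc : IsGeodesicallyComplete g.leviCivita)
    (hRic : ∀ (x : M) (w : TangentSpace 𝓘(ℝ, E) x),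
      -((Module.finrank ℝ E : ℝ) - 1) * g.val x w w ≤ g.leviCivita.ricci x w w)
    (y : M) {c R : ℝ} (hc0 : 0 < c) (hcR : c < R) {G G' G2 : ℝ → ℝ}
    (hGd : ∀ r ∈ Ioo (c / 2) (2 * R), HasDerivAt G (G' r) r)
    (hG2 : ∀ r ∈ Ioo (c / 2) (2 * R), HasDerivAt G' (G2 r) r)
    (hstrict : StrictAntiOn G (Icc c R))
    (hGR : G R = 0) {b b' : ℝ} (hbb' : b < b')
    (hmodel : ∀ r ∈ Ioo c R, b' ≤ G2 r + ((Module.finrank ℝ E : ℝ) - 1) * (Real.cosh r / Real.sinh r) * G' r)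
    {u : M → ℝ} (hucont : Continuous u) {a : ℝ} (ha : 0 ≤ a)
    (hlip : ∀ x z : M, |u x - u z| ≤ a * (g.edist hg x z).toReal)
    (hnonneg : ∀ x, g.edist hg y x ≤ ENNReal.ofReal R → 0 ≤ u x)
    {y₀ : M} (hy₀ : g.edist hg y y₀ < ENNReal.ofReal R) (huy₀ : u y₀ = 0)
    (hu : ∀ x, g.edist hg y x < ENNReal.ofReal R →
      ∀ ε > 0, ∃ φ : M → ℝ, (∀ᶠ x' in 𝓝 x, ContMDiffAt 𝓘(ℝ, E) 𝓘(ℝ, ℝ) 2 φ x') ∧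
        IsLocalMax (fun x' ↦ u x' - φ x') x ∧ g.laplaceBeltrami φ x ≤ b + ε) :
    u y ≤ a * c + G c := by
  have hR : 0 < R := hc0.trans hcR
  by_contra hcon
  rw [not_le] at hcon
  have hGc : 0 < G c := by
    rw [← hGR]; exact hstrict (left_mem_Icc.2 hcR.le) (right_mem_Icc.2 hcR.le) hcR
  -- `G ∘ d(y, ·) ≤ u` on the closed annulus `{c ≤ d ≤ R}`
  have hann := comp_edist_le_of_upper_barriers_annulus_hyperbolic g hg hc hRic y hc0 hcR hGd hG2
    hstrict.antitoneOn hbb'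
    hmodel hucont.continuousOn (fun x hxc hxR ε hε ↦ hu x hxR ε hε) ?_ ?_
  rotate_left
  · -- inner sphere: `u x ≥ u y - a c > G c`
    intro x hx
    have h1 := hlip y x
    rw [hx, ENNReal.toReal_ofReal hc0.le, abs_le] at h1
    linarith [h1.2]
  · -- outer sphere: `u ≥ 0 = G R`
    intro x hx
    rw [hGR]; exact hnonneg x hx.le
  -- the point `y₀`
  by_cases hcy₀ : ENNReal.ofReal c ≤ g.edist hg y y₀
  · have h := hann y₀ hcy₀ hy₀.le
    rw [huy₀] at h
    have hd : (g.edist hg y y₀).toReal ∈ Ico c R :=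
      ⟨(ENNReal.ofReal_le_iff_le_toReal (ne_top_of_lt hy₀)).1 hcy₀,
       ENNReal.toReal_lt_of_lt_ofReal hy₀⟩
    have hpos : 0 < G (g.edist hg y y₀).toReal := by
      rw [← hGR]
      exact hstrict ⟨hd.1, hd.2.le⟩ (right_mem_Icc.2 hcR.le) hd.2
    linarith
  · rw [not_le] at hcy₀
    have hd : (g.edist hg y y₀).toReal < c := ENNReal.toReal_lt_of_lt_ofReal hcy₀
    have h1 := hlip y y₀
    rw [huy₀, sub_zero, abs_le] at h1
    have : u y ≤ a * c := h1.2.trans (by nlinarith [hd, ha])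
    linarith

end AGLemmaHyp
/-! ### §4 The Abresch–Gromoll lemma with a defect `u(y₀) ≤ δ` (Cheeger–Colding 1996, Prop. 6.2) -/

section AGLemmaDefect

variable {E : Type*} [NormedAddCommGroup E] [NormedSpace ℝ E] [FiniteDimensional ℝ E]
  [CompleteSpace E] {M : Type*} [TopologicalSpace M] [ChartedSpace E M] [IsManifold 𝓘(ℝ, E) ∞ M]
  [T2Space M]
  (g : PseudoRiemannianMetric 𝓘(ℝ, E) ∞ E (TangentSpace 𝓘(ℝ, E) : M → Type _)) [g.HasLeviCivita]
  [CovariantDerivative.ContMDiffCovariantDerivative g.leviCivita 1]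
  [CovariantDerivative.ContMDiffCovariantDerivative g.leviCivita ∞]

/-- **The Abresch–Gromoll lemma with a defect, `Ric ≥ -(m-1)`** (Cheeger–Colding 1996, proof of
Prop. 6.2: "The only difference between our hypotheses and those of [AG] is that rather than
assuming `E(p) = 0`, we have assumed (6.4) [`E(p) ≤ τR`] … the function `E - G` cannot take its
minimum on `∂B_{1+ψ}(x)` if (6.10) `τR < G(1) - G(1+ψ)`"). As `abreschGromoll_lemma_hyperbolic`,
but with `u(y₀) ≤ δ` (`δ ≥ 0`) in place of `u(y₀) = 0`, under the extra hypothesis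
`δ < G(d(y, y₀))` when `d(y, y₀) ≥ c`; conclusion `u(y) ≤ a c + G(c) + δ`.
[cite: CheegerColding1996, Prop. 6.2 (proof, (6.8)–(6.10))] -/
theorem abreschGromoll_lemma_hyperbolic_of_le [ConnectedSpace M] (hg : g.IsRiemannian)
    (hc : IsGeodesicallyComplete g.leviCivita)
    (hRic : ∀ (x : M) (w : TangentSpace 𝓘(ℝ, E) x),
      -((Module.finrank ℝ E : ℝ) - 1) * g.val x w w ≤ g.leviCivita.ricci x w w)
    (y : M) {c R : ℝ} (hc0 : 0 < c) (hcR : c < R) {G G' G2 : ℝ → ℝ}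
    (hGd : ∀ r ∈ Ioo (c / 2) (2 * R), HasDerivAt G (G' r) r)
    (hG2 : ∀ r ∈ Ioo (c / 2) (2 * R), HasDerivAt G' (G2 r) r)
    (hstrict : StrictAntiOn G (Icc c R))
    (hGR : G R = 0) {b b' : ℝ} (hbb' : b < b')
    (hmodel : ∀ r ∈ Ioo c R, b' ≤ G2 r + ((Module.finrank ℝ E : ℝ) - 1) * (Real.cosh r / Real.sinh r) * G' r)
    {u : M → ℝ} (hucont : Continuous u) {a : ℝ} (ha : 0 ≤ a)
    (hlip : ∀ x z : M, |u x - u z| ≤ a * (g.edist hg x z).toReal)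
    (hnonneg : ∀ x, g.edist hg y x ≤ ENNReal.ofReal R → 0 ≤ u x)
    {y₀ : M} (hy₀ : g.edist hg y y₀ < ENNReal.ofReal R) {δ : ℝ} (hδ : 0 ≤ δ) (huy₀ : u y₀ ≤ δ)
    (hGδ : ENNReal.ofReal c ≤ g.edist hg y y₀ → δ < G (g.edist hg y y₀).toReal)
    (hu : ∀ x, g.edist hg y x < ENNReal.ofReal R →
      ∀ ε > 0, ∃ φ : M → ℝ, (∀ᶠ x' in 𝓝 x, ContMDiffAt 𝓘(ℝ, E) 𝓘(ℝ, ℝ) 2 φ x') ∧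
        IsLocalMax (fun x' ↦ u x' - φ x') x ∧ g.laplaceBeltrami φ x ≤ b + ε) :
    u y ≤ a * c + G c + δ := by
  have hR : 0 < R := hc0.trans hcR
  by_contra hcon
  rw [not_le] at hcon
  have hGc : 0 ≤ G c := by
    rw [← hGR]; exact (hstrict (left_mem_Icc.2 hcR.le) (right_mem_Icc.2 hcR.le) hcR).le
  -- `G ∘ d(y, ·) ≤ u` on the closed annulus `{c ≤ d ≤ R}`
  have hann := comp_edist_le_of_upper_barriers_annulus_hyperbolic g hg hc hRic y hc0 hcR hGd hG2
    hstrict.antitoneOn hbb'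
    hmodel hucont.continuousOn (fun x hxc hxR ε hε ↦ hu x hxR ε hε) ?_ ?_
  rotate_left
  · -- inner sphere: `u x ≥ u y - a c > G c + δ ≥ G c`
    intro x hx
    have h1 := hlip y x
    rw [hx, ENNReal.toReal_ofReal hc0.le, abs_le] at h1
    linarith [h1.2]
  · -- outer sphere: `u ≥ 0 = G R`
    intro x hx
    rw [hGR]; exact hnonneg x hx.le
  -- the point `y₀`
  by_cases hcy₀ : ENNReal.ofReal c ≤ g.edist hg y y₀
  · have h := hann y₀ hcy₀ hy₀.le
    have h2 := hGδ hcy₀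
    linarith
  · rw [not_le] at hcy₀
    have hd : (g.edist hg y y₀).toReal < c := ENNReal.toReal_lt_of_lt_ofReal hcy₀
    have h1 := hlip y y₀
    rw [abs_le] at h1
    have : u y ≤ a * c + δ := by nlinarith [hd, ha, h1.2]
    linarith

end AGLemmaDefect


end Literature.Geometry.Riemannian

end
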